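import Literature.Topology.FourManifolds.HCobordismAdjustFieldTrack
import HarnessLib

/-!
# Milnor 1965, Lemma 4.7 (to the right of a level) with the track of the isotopy and the
# explicit reparametrisation of its stages

Topic `Literature/Topology/FourManifolds`; a brick for the fact seat of
`Literature.Topology.FourManifolds.Cobordism.Milnor1965_basisTheorem_slab` (one-slide step of the
Basis Theorem 7.6 on a slab, Milnor, *Lectures on the h-cobordism theorem* (1965), PDF
pp. 50–52).  The tree's `Literature.Topology.FourManifolds.Cobordism.Milnor1965_adjust_field_right_track`
(`HCobordismAdjustFieldTrack.lean`) proves Lemma 4.7 together with the printed description of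
the new trajectories inside the band (proof of Thm. 4.4, PDF p. 24: *"for each fixed `q ∈ V`,
`φ(t, h_t(q))` describes an integral curve of `ξ̄`"*): the new trajectory from `ι (F₁ q)` passes,
at the level `b + τ`, through the old trajectory from `ι (F_{ν(b+τ)} q)`, for SOME continuous
`ν : ℝ → [0, 1]` with `ν b = 1`, `ν b' = 0`.  To count the points in which the slid left-hand
disc meets a right-hand disc (proof of Thm. 7.6, PDF p. 52: *"`D_L'(p_1)` intersects `D_R(p_2)`
in a single point, transversally"*) one needs `ν` to be smooth and strictly monotone across the
band.  The construction of `HCobordismAdjustFieldTrack.lean` has this: its `ν` is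
`t ↦ Real.smoothTransition ((t₂ - t) / (t₂ - t₁))` for levels `b < t₁ < t₂ < b'`.  This file
re-runs that construction verbatim, exporting the formula:

* `AmbientIsotopy.exists_stageFamily_trackFormula` — the adjusted stages `k (t, ·) = F_{ν(t)}`
  with `ν t = Real.smoothTransition ((t₂ - t) / (t₂ - t₁))`;
* **`Cobordism.Milnor1965_adjust_field_right_trackFormula`** — Lemma 4.7 (right-hand version)
  with the track and with `ν` given by that formula for some `b < t₁ < t₂ < b'`.

Everything is proved; no definitions, no named facts.  (Proofs: those of
`HCobordismAdjustFieldTrack.lean`, unchanged but for the bookkeeping of `t₁`, `t₂`.)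

## References

* J. Milnor, *Lectures on the h-cobordism theorem*, notes by L. Siebenmann and J. Sondow,
  Princeton Mathematical Notes (1965), Lemma 4.7 and the proof of Thm. 4.4 (PDF pp. 24–25),
  proof of Thm. 7.6 (PDF pp. 50–52).  Held: `lit read book:milnornd-lectures-h-cobordism-theorem`.
  [MilnorHCobordism1965]
* M. W. Hirsch, *Differential Topology*, GTM 33 (1976), Ch. 8 §1 (isotopies and their tracks).
  [HirschDT1976]
-/

open scoped Manifold ContDiff Topology
open Set Function Filter VectorField

noncomputable section

namespace Literature.Topology.FourManifolds

universe u

/-! ### The adjusted isotopy with its reparametrisation -/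

section Stages

variable {EN : Type*} [NormedAddCommGroup EN] [NormedSpace ℝ EN] [CompleteSpace EN]
  {HN : Type*} [TopologicalSpace HN] {J : ModelWithCorners ℝ EN HN} [J.Boundaryless]
  {V : Type*} [TopologicalSpace V] [ChartedSpace HN V] [IsManifold J ∞ V]

/-- **The adjusted isotopy and its inverses, with the reparametrisation given by a formula**: as
`AmbientIsotopy.exists_stageFamily` (`HCobordismAdjustField.lean`), and moreover the stages are
`k (t, ·) = F_{ν(t)}` for a smooth `ν : ℝ → [0, 1]` with `ν = 1` on `(-∞, t₁]`, `ν = 0` on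
`[t₂, ∞)` (the same construction; the extra clause records Milnor's *"`h_t(q)` is a smooth
isotopy from the identity to `h`"*, needed to follow the new trajectories inside the band).
[cite: MilnorHCobordism1965, proof of Thm. 4.4 (PDF p. 24)] [cite: HirschDT1976, Ch. 8 §1] -/
theorem AmbientIsotopy.exists_stageFamily_trackFormula (F : AmbientIsotopy J V) {t₁ t₂ : ℝ}
    (ht : t₁ < t₂) :
    ∃ k kinv : ℝ × V → V, ContMDiff (𝓘(ℝ, ℝ).prod J) J ∞ k ∧ ContMDiff (𝓘(ℝ, ℝ).prod J) J ∞ kinv ∧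
      (∀ t q, kinv (t, k (t, q)) = q) ∧ (∀ t q, k (t, kinv (t, q)) = q) ∧
      (∀ t, t ≤ t₁ → ∀ q, k (t, q) = F.toFun 1 q) ∧ (∀ t, t₂ ≤ t → ∀ q, k (t, q) = q) ∧
      (∀ t t', t ≤ t₁ → t' ≤ t₁ → ∀ q, kinv (t, q) = kinv (t', q)) ∧
      (∀ t t', t₂ ≤ t → t₂ ≤ t' → ∀ q, kinv (t, q) = kinv (t', q)) ∧
      ∃ ν : ℝ → ℝ, ContDiff ℝ ∞ ν ∧ (∀ t, t ≤ t₁ → ν t = 1) ∧ (∀ t, t₂ ≤ t → ν t = 0) ∧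
        (∀ t, 0 ≤ ν t ∧ ν t ≤ 1) ∧ (∀ t q, k (t, q) = F.toFun (ν t) q) ∧
        ∀ t, ν t = Real.smoothTransition ((t₂ - t) / (t₂ - t₁)) := by
  -- the reparametrisation `ν`
  set ν : ℝ → ℝ := fun t => Real.smoothTransition ((t₂ - t) / (t₂ - t₁)) with hν_def
  have hν : ContDiff ℝ ∞ ν :=
    Real.smoothTransition.contDiff.comp ((contDiff_const.sub contDiff_id).div_const _)
  have hν1 : ∀ t, t ≤ t₁ → ν t = 1 := fun t ht' => by
    simp only [hν_def]
    apply Real.smoothTransition.one_of_one_le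
    rw [le_div_iff₀ (by linarith)]; linarith
  have hν0 : ∀ t, t₂ ≤ t → ν t = 0 := fun t ht' => by
    simp only [hν_def]
    apply Real.smoothTransition.zero_of_nonpos
    exact div_nonpos_of_nonpos_of_nonneg (by linarith) (by linarith)
  -- the track diffeomorphism and its inverse
  set Tr := F.trackDiffeomorph with hTr
  have hTr_apply : ∀ s q, Tr (s, q) = (s, F.toFun s q) := fun s q => rfl
  have hsymm₁ : ∀ s q, Tr.symm (s, F.toFun s q) = (s, q) := fun s q => by
    rw [← hTr_apply, Diffeomorph.symm_apply_apply]
  have hsymm₂ : ∀ s y, (Tr.symm (s, y)).1 = s ∧ F.toFun s (Tr.symm (s, y)).2 = y := by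
    intro s y
    have h := Diffeomorph.apply_symm_apply Tr (s, y)
    rcases hq : Tr.symm (s, y) with ⟨s', q'⟩
    rw [hq, hTr_apply, Prod.mk.injEq] at h
    obtain ⟨rfl, h2⟩ := h
    exact ⟨rfl, h2⟩
  refine ⟨fun p => F.toFun (ν p.1) p.2, fun p => (Tr.symm (ν p.1, p.2)).2, ?_, ?_, ?_, ?_, ?_, ?_,
    ?_, ?_, ν, hν, hν1, hν0, fun t => ⟨Real.smoothTransition.nonneg _, Real.smoothTransition.le_one _⟩,
    fun t q => rfl, fun t => rfl⟩
  · exact F.contMDiff.comp ((hν.contMDiff.comp contMDiff_fst).prodMk contMDiff_snd)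
  · exact contMDiff_snd.comp
      (Tr.symm.contMDiff.comp ((hν.contMDiff.comp contMDiff_fst).prodMk contMDiff_snd))
  · intro t q
    show (Tr.symm (ν t, F.toFun (ν t) q)).2 = q
    rw [hsymm₁]
  · intro t y
    exact (hsymm₂ (ν t) y).2
  · intro t ht' q
    show F.toFun (ν t) q = F.toFun 1 q
    rw [hν1 t ht']
  · intro t ht' q
    show F.toFun (ν t) q = q
    rw [hν0 t ht', F.map_zero, id]
  · intro t t' ht' ht'' q
    show (Tr.symm (ν t, q)).2 = (Tr.symm (ν t', q)).2
    rw [hν1 t ht', hν1 t' ht'']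
  · intro t t' ht' ht'' q
    show (Tr.symm (ν t, q)).2 = (Tr.symm (ν t', q)).2
    rw [hν0 t ht', hν0 t' ht'']


end Stages

/-! ### Lemma 4.7 (to the right of `V`) with the track -/

section Main

open Cobordism in
/-- **Milnor 1965, Lemma 4.7 (to the right of `V`) with the track of the isotopy and the
formula for its reparametrisation.**  The same
statement and proof as `Cobordism.Milnor1965_adjust_field_right_holds`
(`HCobordismAdjustField.lean`: the new gradient-like field `ξ'` agrees with `ξ` off `f⁻¹(b, b')`,
and the translation `f⁻¹(b) → f⁻¹(b')` along `ξ'` is the old one composed with `F₁`), together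
with the description of the NEW trajectories inside the band which the printed proof provides
(PDF p. 24: *"for each fixed `q ∈ V`, `φ(t, h_t(q))` describes an integral curve of `ξ̄`"*):
there is a continuous `ν : ℝ → [0, 1]`, `ν b = 1`, `ν b' = 0`, such that for every `q : V` and
`0 ≤ τ ≤ b' - b` the new trajectory from `ι (F₁ q)` and the old trajectory from
`ι (F_{ν(b + τ)} q)` pass through one and the same point of the level `b + τ` — the new
trajectory runs through the band along the points `φ(b + τ, F_{ν(b+τ)} q)`.  This is the
form of Lemma 4.7 needed to compute the homology class of a left-hand disc after a handle slide
(Milnor's Thm. 7.6, PDF pp. 50–52). [cite: MilnorHCobordism1965, Lemma 4.7 (PDF p. 25) with the proof of Thm. 4.4 (PDF p. 24); proof of Thm. 7.6 (PDF pp. 50–52)] -/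
theorem Cobordism.Milnor1965_adjust_field_right_trackFormula :
  ∀ {n : ℕ} {M N : Type u} [TopologicalSpace M] [T2Space M] [SecondCountableTopology M]
    [ChartedSpace (EuclideanSpace ℝ (Fin n)) M] [IsManifold (𝓡 n) ∞ M] [CompactSpace M]
    [TopologicalSpace N] [T2Space N] [SecondCountableTopology N] [ChartedSpace (EuclideanSpace ℝ (Fin n)) N]
    [IsManifold (𝓡 n) ∞ N] [CompactSpace N] {c : Cobordism n M N} {f : c.W → ℝ}
    (_ : c.IsMorseFunction f)
    (ξ : Cₛ^∞⟮𝓡∂ (n + 1); EuclideanSpace ℝ (Fin (n + 1)), (TangentSpace (𝓡∂ (n + 1)) : c.W → Type)⟯)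
    (_ : IsGradientLike (𝓡∂ (n + 1)) f ξ) {b b' : ℝ} (_ : 0 < b) (_ : b < b') (_ : b' < 1)
    (_ : ∀ z ∈ criticalSet (𝓡∂ (n + 1)) f, f z ∉ Icc b b')
    (V : Type u) [TopologicalSpace V] [T2Space V] [SecondCountableTopology V] [CompactSpace V]
    [ChartedSpace (EuclideanSpace ℝ (Fin n)) V] [IsManifold (𝓡 n) ∞ V] (ι : V → c.W)
    (_ : Manifold.IsSmoothEmbedding (𝓡 n) (𝓡∂ (n + 1)) ∞ ι) (_ : range ι = f ⁻¹' {b})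
    (F : AmbientIsotopy (𝓡 n) V),
    ∃ ξ' : Cₛ^∞⟮𝓡∂ (n + 1); EuclideanSpace ℝ (Fin (n + 1)), (TangentSpace (𝓡∂ (n + 1)) : c.W → Type)⟯,
      IsGradientLike (𝓡∂ (n + 1)) f ξ' ∧
      (∀ z, f z ∉ Ioo b b' → ξ' z = ξ z) ∧
      (∀ x, f x = b' → ∀ v : V, FlowsTo (𝓡∂ (n + 1)) ξ (ι v) x →
        FlowsTo (𝓡∂ (n + 1)) ξ' (ι (F.toFun 1 v)) x) ∧
      (∀ x, f x = b' → ∀ v : V, FlowsTo (𝓡∂ (n + 1)) ξ' (ι v) x →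
        ∃ v₀ : V, F.toFun 1 v₀ = v ∧ FlowsTo (𝓡∂ (n + 1)) ξ (ι v₀) x) ∧
      ∃ ν : ℝ → ℝ, Continuous ν ∧ ν b = 1 ∧ ν b' = 0 ∧ (∀ t, 0 ≤ ν t ∧ ν t ≤ 1) ∧
        (∃ t₁ t₂ : ℝ, b < t₁ ∧ t₁ < t₂ ∧ t₂ < b' ∧
          ∀ t, ν t = Real.smoothTransition ((t₂ - t) / (t₂ - t₁))) ∧
        ∀ q : V, ∀ τ ∈ Icc 0 (b' - b), ∃ y : c.W, f y = b + τ ∧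
          FlowsTo (𝓡∂ (n + 1)) ξ (ι (F.toFun (ν (b + τ)) q)) y ∧
          FlowsTo (𝓡∂ (n + 1)) ξ' (ι (F.toFun 1 q)) y := by
  intro n M N _ _ _ _ _ _ _ _ _ _ _ _ c f hf ξ hξ b b' hb hbb' hb'1 hcrit V _ _ _ _ _ _ ι hι hrange F
  classical
  -- the degenerate case of an empty level
  rcases isEmpty_or_nonempty V with hV | hV
  · refine ⟨ξ, hξ, fun z _ => rfl, fun x _ v => (IsEmpty.false v).elim,
      fun x _ v => (IsEmpty.false v).elim,
      fun t => Real.smoothTransition (((b + 2 * b') / 3 - t) / ((b + 2 * b') / 3 - (2 * b + b') / 3)),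
      Real.smoothTransition.continuous.comp (by fun_prop), ?_, ?_,
      fun t => ⟨Real.smoothTransition.nonneg _, Real.smoothTransition.le_one _⟩,
      ⟨(2 * b + b') / 3, (b + 2 * b') / 3, by linarith, by linarith, by linarith, fun t => rfl⟩,
      fun q => (IsEmpty.false q).elim⟩
    · apply Real.smoothTransition.one_of_one_le
      rw [le_div_iff₀ (by linarith)]; linarith
    · apply Real.smoothTransition.zero_of_nonpos
      exact div_nonpos_of_nonpos_of_nonneg (by linarith) (by linarith)
  have hfs : ContMDiff (𝓡∂ (n + 1)) 𝓘(ℝ, ℝ) ∞ f := hf.1.contMDiff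
  have hfd : MDifferentiable (𝓡∂ (n + 1)) 𝓘(ℝ, ℝ) f := hfs.mdifferentiable (by simp)
  set s : c.W → ℝ := fun w => mlineDeriv (𝓡∂ (n + 1)) f w (ξ w) with hs_def
  have hs : ContMDiff (𝓡∂ (n + 1)) 𝓘(ℝ, ℝ) ∞ s := contMDiff_mlineDeriv_section hfs ξ.contMDiff
  have hinj : Injective ι := hι.isEmbedding.injective
  ----------------------------------------------------------------------------------------------
  -- Step 1: a margin `δ` around `[b, b']` free of critical values
  ----------------------------------------------------------------------------------------------
  have hK : IsCompact (criticalSet (𝓡∂ (n + 1)) f) :=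
    (hξ.isClosed_criticalSet hs.continuous).isCompact
  obtain ⟨δ, hδ, hδb, hδb', hδ4, hcritδ⟩ :=
    exists_margin_of_forall_notMem_Icc hK hfs.continuous hb hbb' hb'1 hcrit
  have hreg : ∀ w, f w ∈ Icc (b - 3 * δ) (b' + 3 * δ) → ¬ IsMCriticalPt (𝓡∂ (n + 1)) f w :=
    fun w hw hc => hcritδ w hc hw
  have hs_pos : ∀ w, f w ∈ Icc (b - 3 * δ) (b' + 3 * δ) → 0 < s w := fun w hw =>
    hξ.mlineDeriv_pos w (hreg w hw)
  ----------------------------------------------------------------------------------------------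
  -- Step 2: the normalised field `Y = ρ ξ` (`Y(f) = 1` on `f⁻¹[lo, hi]`) and its flow `θ`
  ----------------------------------------------------------------------------------------------
  set lo : ℝ := b - 2 * δ with hlo_def
  set hi : ℝ := b' + 2 * δ with hhi_def
  obtain ⟨ρ, θ, hρ, hρpos, hρs, hB⟩ := hf.exists_isUnitBandFlow ξ hξ (l₁ := b - 3 * δ) (l₂ := lo)
    (r₂ := hi) (r₁ := b' + 3 * δ) (by linarith) (by simp only [hlo_def]; linarith)
    (by simp only [hlo_def, hhi_def]; linarith) (by simp only [hhi_def]; linarith) (by linarith)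
    hcritδ
  set Y : Π w : c.W, TangentSpace (𝓡∂ (n + 1)) w := fun w => ρ w • ξ w with hY_def
  set ζ : Π w : c.W, TangentSpace (𝓡∂ (n + 1)) w := slabField f Y lo hi with hζ_def
  have hlo : 0 < lo := by simp only [hlo_def]; linarith
  have hhi : hi < 1 := by simp only [hhi_def]; linarith
  have hbmem : b ∈ Ioo lo hi := ⟨by simp only [hlo_def]; linarith, by simp only [hhi_def]; linarith⟩
  have hIcc : Icc lo hi ⊆ Icc (b - 3 * δ) (b' + 3 * δ) :=
    Icc_subset_Icc (by simp only [hlo_def]; linarith) (by simp only [hhi_def]; linarith)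
  have hζY : ∀ w, f w ∈ Icc lo hi → ζ w = Y w := fun w hw => slabField_eq_of_mem_Icc hlo hhi hw
  have hsY : ∀ w, f w ∈ Icc lo hi → s w • Y w = ξ w := fun w hw => by
    show s w • (ρ w • ξ w) = ξ w
    rw [smul_smul, mul_comm, hρs w hw, one_smul]
  ----------------------------------------------------------------------------------------------
  -- Step 3: the adjusted isotopy `k (t, ·) = F_{ν(t)}` and its inverses
  ----------------------------------------------------------------------------------------------
  obtain ⟨k, kinv, hk, hkinv, hkk', hk'k, hk₁, hk₂, hkinv₁, hkinv₂, ν, hν, hν1, hν0, hν01, hkν,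
      hνformula⟩ :=
    F.exists_stageFamily_trackFormula (t₁ := b + δ) (t₂ := b' - δ) (by linarith)
  ----------------------------------------------------------------------------------------------
  -- Step 4: the push-forward `Y'` of `ζ` along the twist `φ K φ⁻¹`, and the new field
  ----------------------------------------------------------------------------------------------
  set Y' : Π w : c.W, TangentSpace (𝓡∂ (n + 1)) w :=
    mpullback (𝓡∂ (n + 1)) (𝓡∂ (n + 1)) (bandTwist ι θ f b kinv) ζ with hY'_def
  -- near the two ends of the band `Y' = ζ`
  have hloc : ∀ w, f w ∈ Ioo lo hi → (f w < b + δ ∨ b' - δ < f w) → Y' w = ζ w := by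
    intro w hw hw'
    apply hB.mpullback_bandTwist_eq_self hbmem hι hrange hk hkinv hkk' hk'k hw
    rcases hw' with h1 | h2
    · filter_upwards [isOpen_Iio.mem_nhds h1] with t ht
      exact fun q => hkinv₁ t (f w) (le_of_lt ht) h1.le q
    · filter_upwards [isOpen_Ioi.mem_nhds h2] with t ht
      exact fun q => hkinv₂ t (f w) (le_of_lt ht) h2.le q
  -- the new field as a function
  set ξ'f : Π w : c.W, TangentSpace (𝓡∂ (n + 1)) w :=
    fun w => if f w ∈ Ioo lo hi then s w • Y' w else ξ w with hξ'f_def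
  have hξ'in : ∀ w, f w ∈ Ioo lo hi → ξ'f w = s w • Y' w := fun w hw => if_pos hw
  have hξ'eq : ∀ w, (f w < b + δ ∨ b' - δ < f w) → ξ'f w = ξ w := by
    intro w hw
    by_cases hw' : f w ∈ Ioo lo hi
    · rw [hξ'in w hw', hloc w hw' hw, hζY w (Ioo_subset_Icc_self hw'),
        hsY w (Ioo_subset_Icc_self hw')]
    · exact if_neg hw'
  have hO : IsOpen {w : c.W | f w < b + δ ∨ b' - δ < f w} :=
    (isOpen_lt hfs.continuous continuous_const).union (isOpen_lt continuous_const hfs.continuous)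
  -- smoothness
  have hsmooth : ContMDiff (𝓡∂ (n + 1)) (𝓡∂ (n + 1)).tangent ∞
      (fun w => (⟨w, ξ'f w⟩ : TangentBundle (𝓡∂ (n + 1)) c.W)) := by
    intro w
    by_cases hw : f w < b + δ ∨ b' - δ < f w
    · have hev : (fun y => (⟨y, ξ'f y⟩ : TangentBundle (𝓡∂ (n + 1)) c.W)) =ᶠ[𝓝 w]
          fun y => (⟨y, ξ y⟩ : TangentBundle (𝓡∂ (n + 1)) c.W) := by
        filter_upwards [hO.mem_nhds hw] with y hy
        rw [hξ'eq y hy]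
      exact (ξ.contMDiff w).congr_of_eventuallyEq hev
    · simp only [not_or, not_lt] at hw
      have hwU : f w ∈ Ioo lo hi :=
        ⟨by simp only [hlo_def]; linarith [hw.1], by simp only [hhi_def]; linarith [hw.2]⟩
      have hev : (fun y => (⟨y, ξ'f y⟩ : TangentBundle (𝓡∂ (n + 1)) c.W)) =ᶠ[𝓝 w]
          fun y => (⟨y, s y • Y' y⟩ : TangentBundle (𝓡∂ (n + 1)) c.W) := by
        filter_upwards [hB.isOpen_band.mem_nhds hwU] with y hy
        rw [hξ'in y hy]
      exact ((hs w).smul_section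
        (hB.contMDiffAt_mpullback_bandTwist hbmem hι hrange hk hkinv hkk' hk'k hwU)
          ).congr_of_eventuallyEq hev
  set ξ' : Cₛ^∞⟮𝓡∂ (n + 1); EuclideanSpace ℝ (Fin (n + 1)), (TangentSpace (𝓡∂ (n + 1)) : c.W → Type)⟯ :=
    ⟨ξ'f, hsmooth⟩ with hξ'_def
  have hξ'ap : ∀ w, ξ' w = ξ'f w := fun w => rfl
  ----------------------------------------------------------------------------------------------
  -- Step 5: the new field is gradient-like and agrees with `ξ` off `f⁻¹(b, b')`
  ----------------------------------------------------------------------------------------------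
  have hpos' : ∀ p, ¬ IsMCriticalPt (𝓡∂ (n + 1)) f p →
      0 < mlineDeriv (𝓡∂ (n + 1)) f p (ξ' p) := by
    intro p hp
    rw [hξ'ap]
    by_cases hpU : f p ∈ Ioo lo hi
    · rw [hξ'in p hpU, mlineDeriv_smul,
        hB.mlineDeriv_mpullback_bandTwist hbmem hι hrange hk hkinv hkk' hk'k hpU, mul_one]
      exact hξ.mlineDeriv_pos p hp
    · rw [show ξ'f p = ξ p from if_neg hpU]
      exact hξ.mlineDeriv_pos p hp
  have hGL : IsGradientLike (𝓡∂ (n + 1)) f ξ' := by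
    refine hξ.of_locallyEq hpos' fun p hp => ⟨{w | f w < b + δ ∨ b' - δ < f w}, hO, ?_,
      fun _ _ => rfl, fun q hq => hξ'eq q hq⟩
    -- a critical point has `f p ∉ [b - 3δ, b' + 3δ]`
    have h1 : f p ∉ Icc (b - 3 * δ) (b' + 3 * δ) := hcritδ p hp
    simp only [mem_Icc, not_and_or, not_le] at h1
    show f p < b + δ ∨ b' - δ < f p
    rcases h1 with h1 | h1
    · left; linarith
    · right; linarith
  have hoff : ∀ z, f z ∉ Ioo b b' → ξ' z = ξ z := by
    intro z hz
    rw [hξ'ap]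
    apply hξ'eq
    simp only [mem_Ioo, not_and_or, not_lt] at hz
    rcases hz with hz | hz
    · left; linarith
    · right; linarith
  ----------------------------------------------------------------------------------------------
  -- Step 6: the trajectories.  Old: from `ι q` to `θ (b' - b, ι q)`; new: from `ι (F₁ q)` there.
  ----------------------------------------------------------------------------------------------
  have hbτ : ∀ τ ∈ Icc 0 (b' - b), b + τ ∈ Ioo lo hi := fun τ hτ =>
    ⟨by simp only [hlo_def]; linarith [hτ.1], by simp only [hhi_def]; linarith [hτ.2]⟩
  have hflow_lev : ∀ (q : V), ∀ τ ∈ Icc 0 (b' - b), f (θ (τ, ι q)) = b + τ := fun q τ hτ =>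
    hB.apply_flow_embedding hbmem hrange q (hbτ τ hτ)
  have hend : ∀ q : V, f (θ (b' - b, ι q)) = b' := fun q => by
    rw [hflow_lev q (b' - b) ⟨by linarith, le_rfl⟩, add_sub_cancel]
  have hlevb' : ∀ w, f w = b' → ¬ IsMCriticalPt (𝓡∂ (n + 1)) f w := fun w hw =>
    hreg w (by rw [hw]; exact ⟨by linarith, by linarith⟩)
  -- (i) the old trajectories: the flow lines of `ζ = Y = ρ ξ`, time-changed
  have hflowξ : ∀ q : V, FlowsTo (𝓡∂ (n + 1)) ξ (ι q) (θ (b' - b, ι q)) := by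
    intro q
    have hγ : IsMIntegralCurveOn (fun τ => θ (τ, ι q)) ζ (Icc 0 (b' - b)) :=
      (hB.flow.isMIntegralCurve (ι q)).isMIntegralCurveOn _
    have hmem : ∀ τ ∈ Icc 0 (b' - b), f (θ (τ, ι q)) ∈ Icc lo hi := fun τ hτ => by
      rw [hflow_lev q τ hτ]; exact Ioo_subset_Icc_self (hbτ τ hτ)
    have hρc : Continuous fun τ : ℝ => (ρ (θ (τ, ι q)))⁻¹ :=
      (hρ.continuous.comp (hB.flow.continuous.comp (continuous_id.prodMk continuous_const))).inv₀
        fun τ => (hρpos _).ne'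
    have h := hγ.flowsTo_of_smul_eq (X := (ξ : Π w : c.W, TangentSpace (𝓡∂ (n + 1)) w))
      (r := fun w => (ρ w)⁻¹) (by linarith) hρc.continuousOn (fun τ _ => inv_pos.2 (hρpos _))
      (fun τ hτ => by
        rw [hζY _ (hmem τ hτ)]
        show (ρ (θ (τ, ι q)))⁻¹ • (ρ (θ (τ, ι q)) • ξ (θ (τ, ι q))) = ξ (θ (τ, ι q))
        rw [smul_smul, inv_mul_cancel₀ (hρpos _).ne', one_smul])
    simp only [hB.flow.map_zero] at h
    exact h
  -- (ii) the new trajectories: the twisted flow lines, integral curves of `Y'`, time-changed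
  have hflowξ' : ∀ q : V, FlowsTo (𝓡∂ (n + 1)) ξ' (ι (F.toFun 1 q)) (θ (b' - b, ι q)) := by
    intro q
    have hc : IsMIntegralCurveOn (bandTwist ι θ f b k ∘ fun τ => θ (τ, ι q)) Y' (Icc 0 (b' - b)) :=
      hB.isMIntegralCurveOn_bandTwist_flow hbmem hι hrange hk hkinv hkk' hk'k q
        (by simp only [hhi_def]; linarith)
    have hmem : ∀ τ ∈ Icc 0 (b' - b),
        f ((bandTwist ι θ f b k ∘ fun τ => θ (τ, ι q)) τ) ∈ Ioo lo hi := fun τ hτ => by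
      rw [comp_apply, hB.apply_bandTwist hbmem hrange k (by rw [hflow_lev q τ hτ]; exact hbτ τ hτ),
        hflow_lev q τ hτ]
      exact hbτ τ hτ
    have h := hc.flowsTo_of_smul_eq (X := (ξ' : Π w : c.W, TangentSpace (𝓡∂ (n + 1)) w))
      (r := s) (by linarith) (hs.continuous.comp_continuousOn hc.continuousOn)
      (fun τ hτ => hs_pos _ (hIcc (Ioo_subset_Icc_self (hmem τ hτ))))
      (fun τ hτ => by rw [hξ'ap, hξ'in _ (hmem τ hτ)])
    have h0 : (bandTwist ι θ f b k ∘ fun τ => θ (τ, ι q)) 0 = ι (F.toFun 1 q) := by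
      rw [comp_apply, hB.flow.map_zero, hB.bandTwist_embedding hbmem hinj hrange k q,
        hk₁ b (by linarith) q]
    have h1 : (bandTwist ι θ f b k ∘ fun τ => θ (τ, ι q)) (b' - b) = θ (b' - b, ι q) := by
      rw [comp_apply, hB.bandTwist_flow_embedding hbmem hinj hrange k q (hbτ _ ⟨by linarith, le_rfl⟩),
        add_sub_cancel, hk₂ b' (by linarith) q]
    rw [h0, h1] at h
    exact h
  ----------------------------------------------------------------------------------------------
  -- Conclusion: Lemma 4.7 (a) and (b), `φ̄ = h ∘ φ`.
  ----------------------------------------------------------------------------------------------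
  -- (iii) partial trajectories: up to the level `b + τ₀`
  have hflowξτ : ∀ (q : V), ∀ τ₀ ∈ Icc 0 (b' - b), FlowsTo (𝓡∂ (n + 1)) ξ (ι q) (θ (τ₀, ι q)) := by
    intro q τ₀ hτ₀
    have hγ : IsMIntegralCurveOn (fun τ => θ (τ, ι q)) ζ (Icc 0 τ₀) :=
      (hB.flow.isMIntegralCurve (ι q)).isMIntegralCurveOn _
    have hmem : ∀ τ ∈ Icc 0 τ₀, f (θ (τ, ι q)) ∈ Icc lo hi := fun τ hτ => by
      rw [hflow_lev q τ ⟨hτ.1, hτ.2.trans hτ₀.2⟩]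
      exact Ioo_subset_Icc_self (hbτ τ ⟨hτ.1, hτ.2.trans hτ₀.2⟩)
    have hρc : Continuous fun τ : ℝ => (ρ (θ (τ, ι q)))⁻¹ :=
      (hρ.continuous.comp (hB.flow.continuous.comp (continuous_id.prodMk continuous_const))).inv₀
        fun τ => (hρpos _).ne'
    have h := hγ.flowsTo_of_smul_eq (X := (ξ : Π w : c.W, TangentSpace (𝓡∂ (n + 1)) w))
      (r := fun w => (ρ w)⁻¹) hτ₀.1 hρc.continuousOn (fun τ _ => inv_pos.2 (hρpos _))
      (fun τ hτ => by
        rw [hζY _ (hmem τ hτ)]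
        show (ρ (θ (τ, ι q)))⁻¹ • (ρ (θ (τ, ι q)) • ξ (θ (τ, ι q))) = ξ (θ (τ, ι q))
        rw [smul_smul, inv_mul_cancel₀ (hρpos _).ne', one_smul])
    simp only [hB.flow.map_zero] at h
    exact h
  have hflowξ'τ : ∀ (q : V), ∀ τ₀ ∈ Icc 0 (b' - b),
      FlowsTo (𝓡∂ (n + 1)) ξ' (ι (F.toFun 1 q)) (θ (τ₀, ι (k (b + τ₀, q)))) := by
    intro q τ₀ hτ₀
    have hc : IsMIntegralCurveOn (bandTwist ι θ f b k ∘ fun τ => θ (τ, ι q)) Y' (Icc 0 τ₀) :=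
      (hB.isMIntegralCurveOn_bandTwist_flow hbmem hι hrange hk hkinv hkk' hk'k q
        (by simp only [hhi_def]; linarith)).mono (Icc_subset_Icc le_rfl hτ₀.2)
    have hmem : ∀ τ ∈ Icc 0 τ₀,
        f ((bandTwist ι θ f b k ∘ fun τ => θ (τ, ι q)) τ) ∈ Ioo lo hi := fun τ hτ => by
      have hτ' : τ ∈ Icc 0 (b' - b) := ⟨hτ.1, hτ.2.trans hτ₀.2⟩
      rw [comp_apply, hB.apply_bandTwist hbmem hrange k (by rw [hflow_lev q τ hτ']; exact hbτ τ hτ'),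
        hflow_lev q τ hτ']
      exact hbτ τ hτ'
    have h := hc.flowsTo_of_smul_eq (X := (ξ' : Π w : c.W, TangentSpace (𝓡∂ (n + 1)) w))
      (r := s) hτ₀.1 (hs.continuous.comp_continuousOn hc.continuousOn)
      (fun τ hτ => hs_pos _ (hIcc (Ioo_subset_Icc_self (hmem τ hτ))))
      (fun τ hτ => by rw [hξ'ap, hξ'in _ (hmem τ hτ)])
    have h0 : (bandTwist ι θ f b k ∘ fun τ => θ (τ, ι q)) 0 = ι (F.toFun 1 q) := by
      rw [comp_apply, hB.flow.map_zero, hB.bandTwist_embedding hbmem hinj hrange k q,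
        hk₁ b (by linarith) q]
    have h1 : (bandTwist ι θ f b k ∘ fun τ => θ (τ, ι q)) τ₀ = θ (τ₀, ι (k (b + τ₀, q))) := by
      rw [comp_apply, hB.bandTwist_flow_embedding hbmem hinj hrange k q (hbτ _ hτ₀)]
    rw [h0, h1] at h
    exact h
  refine ⟨ξ', hGL, hoff, ?_, ?_, ν, hν.continuous, hν1 b (by linarith), hν0 b' (by linarith), hν01,
    ⟨b + δ, b' - δ, by linarith, by linarith, by linarith, hνformula⟩,
    fun q τ hτ => ⟨θ (τ, ι (k (b + τ, q))), hflow_lev _ τ hτ, ?_, hflowξ'τ q τ hτ⟩⟩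
  rotate_left 2
  · -- the track: the old trajectory from `ι (F_{ν(b+τ)} q)` to the same point
    rw [← hkν (b + τ) q]
    exact hflowξτ (k (b + τ, q)) τ hτ
  · -- push: the old trajectory from `ι q` ends where the new one from `ι (F₁ q)` ends
    intro x hx q hflow
    have hx' : x = θ (b' - b, ι q) :=
      FlowsTo.eq_of_apply_eq ξ.contMDiff hfd hξ.mlineDeriv_pos hflow (hflowξ q)
        (by rw [hx, hend q]) (fun w hw => hlevb' w (by rw [hw, hx]))
    rw [hx']
    exact hflowξ' q
  · -- pull: a new trajectory from `ι q` ends at the old end point above `ι (F₁⁻¹ q)`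
    intro x hx v hflow
    set q : V := (F.toDiffeomorph 1).symm v with hq_def
    have hqv : F.toFun 1 q = v := by
      rw [hq_def, ← F.coe_toDiffeomorph, Diffeomorph.apply_symm_apply]
    have h2 := hflowξ' q
    rw [hqv] at h2
    have hx' : x = θ (b' - b, ι q) :=
      FlowsTo.eq_of_apply_eq ξ'.contMDiff hfd hGL.mlineDeriv_pos hflow h2
        (by rw [hx, hend q]) (fun w hw => hlevb' w (by rw [hw, hx]))
    refine ⟨q, hqv, ?_⟩
    rw [hx']
    exact hflowξ q

end Main

end Literature.Topology.FourManifolds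

end
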